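import Literature.NumberTheory.Transcendental.KZLogCalculusProofs
import Literature.NumberTheory.Transcendental.KZSemialgebraicComplex
import Literature.ModelTheory.ExponentialFields.SemialgebraicComponents
import Summits.KontsevichZagierPeriods.KontsevichZagierPeriods.Theorems.GammaHodgeSector.Negative.Algebraicity
import Summits.KontsevichZagierPeriods.KontsevichZagierPeriods.Theorems.LiouvilleUnfoldingLogPrimitiveNLStubDescentCells

/-!
# `LogPrimitiveNL` (stmt-KontsevichZagierPeriods-2836), line `logderiv-peeling`, stub `stub_descent` —
part 2: integrating a lattice-valued gradient back

The "integrate back" step of the Kolchin–Ostrowski descent (lead's stub). Linear algebra: for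
integer vectors `f₁, …, f_R ∈ ℤᵏ` there is a rational matrix `B` reproducing every `f_r` from the
family, `f_{r₀} = Σ_r (B_r · f_{r₀}) f_r` (a generalized inverse of `c ↦ Σ c_r f_r` over `ℚ`). Hence
the `ℚ`-rational linear operator `P v := v − Σ_r (B_r · v) f_r` kills the real span of the `f_r`.
Analysis: if `φ : U → ℝᵏ` is differentiable and `ℚ`-semialgebraic on an open `ℚ`-semialgebraic `U`
with every partial derivative `∂ⱼφ(x)` in the real span of the `f_r`, then `Pφ` has zero gradient,
so it is constant on each connected component of `U` (finitely many, open, `ℚ`-semialgebraic), with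
ALGEBRAIC value (value of a `ℚ`-semialgebraic function at a rational point), and
`φ = v + Σ_r q_r f_r` there with `q_r = B_r · φ` `ℚ`-semialgebraic.
-/

noncomputable section

open Set MeasureTheory
open scoped ContDiff
open Literature.NumberTheory.Transcendental Literature.ModelTheory.ExponentialFields

namespace Summit.KontsevichZagierPeriods.LiouvilleUnfolding.LogPrimitiveNL

/-! ### Linear algebra: a rational reproducing matrix for a finite family of integer vectors -/

/-- **Generalized inverse over `ℚ`.** For a `ℚ`-linear map `Φ` between finite-dimensional vector
spaces there is a linear `Ψ` with `Φ (Ψ (Φ c)) = Φ c` (right inverse of the corestriction composed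
with a left inverse of the inclusion of the range). [folklore] -/
theorem descent_exists_generalized_inverse {V W : Type*} [AddCommGroup V] [Module ℚ V]
    [AddCommGroup W] [Module ℚ W] (Φ : V →ₗ[ℚ] W) :
    ∃ Ψ : W →ₗ[ℚ] V, ∀ c, Φ (Ψ (Φ c)) = Φ c := by
  obtain ⟨ρ, hρ⟩ := LinearMap.exists_rightInverse_of_surjective Φ.rangeRestrict
    (LinearMap.range_rangeRestrict Φ)
  obtain ⟨lam, hlam⟩ := LinearMap.exists_leftInverse_of_injective (LinearMap.range Φ).subtype
    (Submodule.ker_subtype _)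
  refine ⟨ρ.comp lam, fun c => ?_⟩
  have h1 : lam (Φ c) = Φ.rangeRestrict c := by
    have := LinearMap.congr_fun hlam (Φ.rangeRestrict c)
    rw [LinearMap.comp_apply, LinearMap.id_apply, Submodule.subtype_apply] at this
    exact this
  have h2 : Φ.rangeRestrict (ρ (Φ.rangeRestrict c)) = Φ.rangeRestrict c := by
    have := LinearMap.congr_fun hρ (Φ.rangeRestrict c)
    rw [LinearMap.comp_apply, LinearMap.id_apply] at this
    exact this
  have h3 := congr_arg (fun z : LinearMap.range Φ => (z : W)) h2
  simp only [LinearMap.codRestrict_apply] at h3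
  rw [LinearMap.comp_apply, h1]
  exact h3

/-- **Rational reproducing matrix.** For integer vectors `f₁, …, f_R ∈ ℤᵏ` there is a rational
matrix `B` with `f_{r₀} = Σ_r (Σ_{i'} B r i' · f r₀ i') · f_r` for every `r₀`. [folklore] -/
theorem descent_lattice_reproduce (k : ℕ) {T : Type*} [Fintype T] [DecidableEq T]
    (f : T → Fin k → ℤ) :
    ∃ B : T → Fin k → ℚ, ∀ r₀ i, (f r₀ i : ℚ) = ∑ r, (∑ i', B r i' * f r₀ i') * f r i := by
  classical
  -- `Φ c = Σ_r c_r f_r`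
  let Φ : (T → ℚ) →ₗ[ℚ] (Fin k → ℚ) :=
    Fintype.linearCombination ℚ (fun r => fun i => (f r i : ℚ))
  have hΦ : ∀ c : T → ℚ, ∀ i, Φ c i = ∑ r, c r * f r i := fun c i => by
    simp [Φ, Fintype.linearCombination_apply, Finset.sum_apply, smul_eq_mul]
  obtain ⟨Ψ, hΨ⟩ := descent_exists_generalized_inverse Φ
  refine ⟨fun r i => Ψ (Pi.single i 1) r, fun r₀ i => ?_⟩
  -- `f_{r₀} = Φ (e_{r₀})`
  have hf : (fun i => (f r₀ i : ℚ)) = Φ (Pi.single r₀ 1) := by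
    funext i
    rw [hΦ]
    simp [Pi.single_apply, Finset.sum_ite_eq']
  -- expand `Ψ v` along the standard basis
  have hsingle : ∀ i' : Fin k, (fun j => if i' = j then (1 : ℚ) else 0) = Pi.single i' 1 := by
    intro i'
    funext j
    simp [Pi.single_apply, eq_comm]
  have hΨv : ∀ (v : Fin k → ℚ) (r : T), Ψ v r = ∑ i', Ψ (Pi.single i' 1) r * v i' := by
    intro v r
    rw [LinearMap.pi_apply_eq_sum_univ Ψ v, Finset.sum_apply]
    refine Finset.sum_congr rfl fun i' _ => ?_
    rw [Pi.smul_apply, smul_eq_mul, mul_comm, hsingle]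
  have key : (f r₀ i : ℚ) = Φ (Ψ (Φ (Pi.single r₀ 1))) i := by
    rw [hΨ, ← hf]
  rw [key, hΦ]
  refine Finset.sum_congr rfl fun r _ => ?_
  rw [hΨv, ← hf]

/-! ### Integrating back -/

/-- **Integrate back** (Kolchin–Ostrowski, one step): on an open `ℚ`-semialgebraic `U ⊆ ℝⁿ`, a
differentiable `ℚ`-semialgebraic `φ : U → ℝᵏ` all of whose partial derivatives lie pointwise in the
real span of integer vectors `f₁, …, f_R` decomposes, on each of the finitely many connected
components `C` of `U` (open, `ℚ`-semialgebraic, pairwise disjoint, covering `U`), as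
`φ = v + Σ_r q_r f_r` with a CONSTANT vector `v` of algebraic entries and `ℚ`-semialgebraic
coefficient functions `q_r`. [folklore] -/
theorem descent_integrateBack {T : Type*} [Fintype T] [DecidableEq T] : ∀ (n k : ℕ)
    (U : Set (Fin n → ℝ)) (φ : Fin k → (Fin n → ℝ) → ℝ) (f : T → Fin k → ℤ),
    IsSemialgebraic ℚ U → IsOpen U → (∀ i, IsSemialgebraicFunOn ℚ U (φ i)) →
    (∀ i, DifferentiableOn ℝ (φ i) U) →
    (∀ j : Fin n, ∀ x ∈ U, ∃ μ : T → ℝ,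
      ∀ i, fderiv ℝ (φ i) x (Pi.single j (1 : ℝ)) = ∑ r, μ r * (f r i : ℝ)) →
    ∃ (N : ℕ) (C : Fin N → Set (Fin n → ℝ)),
      (∀ c, IsSemialgebraic ℚ (C c) ∧ IsOpen (C c) ∧ C c ⊆ U) ∧
      Pairwise (Function.onFun Disjoint C) ∧ (⋃ c, C c) = U ∧
      ∀ c, ∃ (v : Fin k → ℝ) (q : T → (Fin n → ℝ) → ℝ), (∀ i, IsAlgebraic ℚ (v i)) ∧
        (∀ r, IsSemialgebraicFunOn ℚ (C c) (q r)) ∧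
        ∀ i, ∀ x ∈ C c, φ i x = v i + ∑ r, q r x * (f r i : ℝ) := by
  intro n k U φ f hU hUo hφ hφd hspan
  classical
  obtain ⟨B, hB⟩ := descent_lattice_reproduce k f
  -- the coefficient functions `q_r = B_r · φ` and the projected functions `Pφ`
  let q : T → (Fin n → ℝ) → ℝ := fun r x => ∑ i', (B r i' : ℝ) * φ i' x
  let Pφ : Fin k → (Fin n → ℝ) → ℝ := fun i x => φ i x - ∑ r, q r x * (f r i : ℝ)
  have hq_sa : ∀ r, IsSemialgebraicFunOn ℚ U (q r) := fun r =>
    KZ.isSemialgebraicFunOn_finset_sum _ hU fun i' _ =>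
      IsSemialgebraicFunOn.mul_holds (isSemialgebraicFunOn_ratCast hU (B r i')) (hφ i')
  have hPφ_sa : ∀ i, IsSemialgebraicFunOn ℚ U (Pφ i) := fun i =>
    IsSemialgebraicFunOn.sub_holds (hφ i) (KZ.isSemialgebraicFunOn_finset_sum _ hU fun r _ =>
      IsSemialgebraicFunOn.mul_holds (hq_sa r) (by
        simpa using isSemialgebraicFunOn_ratCast hU (f r i : ℚ)))
  have hq_d : ∀ r, DifferentiableOn ℝ (q r) U := fun r =>
    DifferentiableOn.fun_sum fun i' _ => (hφd i').const_mul _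
  have hPφ_d : ∀ i, DifferentiableOn ℝ (Pφ i) U := fun i =>
    (hφd i).sub (DifferentiableOn.fun_sum fun r _ => (hq_d r).mul_const _)
  -- the real operator `P v = v - Σ_r (B_r · v) f_r` kills every `f_{r₀}`, hence the span
  have hPkill : ∀ (μ : T → ℝ) (i : Fin k),
      (∑ r₀, μ r₀ * (f r₀ i : ℝ)) -
        ∑ r, (∑ i', (B r i' : ℝ) * ∑ r₀, μ r₀ * (f r₀ i' : ℝ)) * (f r i : ℝ) = 0 := by
    intro μ i
    have hcast : ∀ r₀, (f r₀ i : ℝ) = ∑ r, (∑ i', (B r i' : ℝ) * (f r₀ i' : ℝ)) * (f r i : ℝ) := by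
      intro r₀
      have := congr_arg (fun t : ℚ => (t : ℝ)) (hB r₀ i)
      push_cast at this
      exact this
    have hrew : ∑ r₀, μ r₀ * (f r₀ i : ℝ) =
        ∑ r₀, μ r₀ * ∑ r, (∑ i', (B r i' : ℝ) * (f r₀ i' : ℝ)) * (f r i : ℝ) :=
      Finset.sum_congr rfl fun r₀ _ => by rw [← hcast r₀]
    rw [hrew, sub_eq_zero]
    simp only [Finset.mul_sum, Finset.sum_mul]
    rw [Finset.sum_comm]
    refine Finset.sum_congr rfl fun r _ => ?_
    rw [Finset.sum_comm]
    exact Finset.sum_congr rfl fun i' _ => Finset.sum_congr rfl fun r₀ _ => by ring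
  -- partial derivatives of `Pφ i` vanish on `U`
  have hderiv : ∀ (j : Fin n) (i : Fin k), ∀ x ∈ U, fderiv ℝ (Pφ i) x (Pi.single j (1 : ℝ)) = 0 := by
    intro j i x hx
    have hxU : U ∈ nhds x := hUo.mem_nhds hx
    have hdφ : ∀ i', DifferentiableAt ℝ (φ i') x := fun i' => (hφd i').differentiableAt hxU
    have hdq : ∀ r, DifferentiableAt ℝ (q r) x := fun r => (hq_d r).differentiableAt hxU
    obtain ⟨μ, hμ⟩ := hspan j x hx
    have hq_deriv : ∀ r, fderiv ℝ (q r) x (Pi.single j (1 : ℝ)) =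
        ∑ i', (B r i' : ℝ) * ∑ r₀, μ r₀ * (f r₀ i' : ℝ) := by
      intro r
      have : fderiv ℝ (q r) x = ∑ i', (B r i' : ℝ) • fderiv ℝ (φ i') x := by
        show fderiv ℝ (fun x => ∑ i', (B r i' : ℝ) * φ i' x) x = _
        rw [fderiv_fun_sum fun i' _ => (hdφ i').const_mul _]
        refine Finset.sum_congr rfl fun i' _ => ?_
        rw [fderiv_const_mul (hdφ i')]
      rw [this, sum_apply]
      refine Finset.sum_congr rfl fun i' _ => ?_
      rw [smul_apply, smul_eq_mul, hμ i']
    have hsum_d : DifferentiableAt ℝ (fun x => ∑ r, q r x * (f r i : ℝ)) x :=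
      DifferentiableAt.fun_sum fun r _ => (hdq r).mul_const _
    have : fderiv ℝ (Pφ i) x = fderiv ℝ (φ i) x - ∑ r, (f r i : ℝ) • fderiv ℝ (q r) x := by
      show fderiv ℝ (fun x => φ i x - ∑ r, q r x * (f r i : ℝ)) x = _
      rw [fderiv_fun_sub (hdφ i) hsum_d, fderiv_fun_sum fun r _ => (hdq r).mul_const _]
      congr 1
      refine Finset.sum_congr rfl fun r _ => ?_
      rw [fderiv_mul_const (hdq r)]
    rw [this, sub_apply, sum_apply, hμ i]
    simp only [smul_apply, smul_eq_mul, hq_deriv]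
    have := hPkill μ i
    calc (∑ r, μ r * (f r i : ℝ)) - ∑ r, (f r i : ℝ) * ∑ i', (B r i' : ℝ) * ∑ r₀, μ r₀ * (f r₀ i' : ℝ)
        = (∑ r₀, μ r₀ * (f r₀ i : ℝ)) -
            ∑ r, (∑ i', (B r i' : ℝ) * ∑ r₀, μ r₀ * (f r₀ i' : ℝ)) * (f r i : ℝ) := by
          congr 1
          exact Finset.sum_congr rfl fun r _ => mul_comm _ _
      _ = 0 := this
  -- the components of `U`
  obtain ⟨N, C, hC, hdisj, hcover⟩ := descent_components hU hUo
  refine ⟨N, C, fun c => ⟨(hC c).1, (hC c).2.1, (hC c).2.2.2.2⟩, hdisj, hcover, fun c => ?_⟩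
  obtain ⟨hCs, hCo, hCconn, ⟨x₀, hx₀⟩, hCU⟩ := hC c
  -- a rational point of the component, and the (algebraic) constant value of `Pφ` there
  obtain ⟨z, hz⟩ := descent_exists_ratCast_mem hCo hx₀
  refine ⟨fun i => Pφ i (fun l => (z l : ℝ)), q, fun i => ?_, fun r => (hq_sa r).mono hCU hCs,
    fun i x hx => ?_⟩
  · exact Summit.KontsevichZagierPeriods.GammaHodgeSectorNegative.isAlgebraic_apply_ratCast
      (hPφ_sa i) z (hCU hz)
  · have hconst : Pφ i x = Pφ i (fun l => (z l : ℝ)) :=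
      descent_const_of_partials_eq_zero hCo hCconn ((hPφ_d i).mono hCU)
        (fun j y hy => hderiv j i y (hCU hy)) hx hz
    show φ i x = Pφ i (fun l => (z l : ℝ)) + ∑ r, q r x * (f r i : ℝ)
    rw [← hconst]
    simp [Pφ]

/-- **Integrate back**, `Fin R`-indexed lattice family (registered ∀-form of
`descent_integrateBack`). [folklore] -/
theorem descent_integrateBack_fin : ∀ (n k R : ℕ) (U : Set (Fin n → ℝ))
    (φ : Fin k → (Fin n → ℝ) → ℝ) (f : Fin R → Fin k → ℤ),
    IsSemialgebraic ℚ U → IsOpen U → (∀ i, IsSemialgebraicFunOn ℚ U (φ i)) →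
    (∀ i, DifferentiableOn ℝ (φ i) U) →
    (∀ j : Fin n, ∀ x ∈ U, ∃ μ : Fin R → ℝ,
      ∀ i, fderiv ℝ (φ i) x (Pi.single j (1 : ℝ)) = ∑ r, μ r * (f r i : ℝ)) →
    ∃ (N : ℕ) (C : Fin N → Set (Fin n → ℝ)),
      (∀ c, IsSemialgebraic ℚ (C c) ∧ IsOpen (C c) ∧ C c ⊆ U) ∧
      Pairwise (Function.onFun Disjoint C) ∧ (⋃ c, C c) = U ∧
      ∀ c, ∃ (v : Fin k → ℝ) (q : Fin R → (Fin n → ℝ) → ℝ), (∀ i, IsAlgebraic ℚ (v i)) ∧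
        (∀ r, IsSemialgebraicFunOn ℚ (C c) (q r)) ∧
        ∀ i, ∀ x ∈ C c, φ i x = v i + ∑ r, q r x * (f r i : ℝ) :=
  fun n k R U φ f => descent_integrateBack (T := Fin R) n k U φ f

end Summit.KontsevichZagierPeriods.LiouvilleUnfolding.LogPrimitiveNL

end
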